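import Literature.NumberTheory.Sieve.SmoothParityTernary
import Literature.NumberTheory.Sieve.SmoothTernaryCircle
import Literature.NumberTheory.Sieve.SmoothTernaryHolder
import Literature.NumberTheory.Sieve.SmoothProfileMinor
import HarnessLib

/-!
# Parity-class friable ternary counts: the circle split and the minor arcs

Topic `Literature/NumberTheory/Sieve`, namespace `Literature.NumberTheory.Sieve.SmoothArcs`; a PROVED sequel of
`SmoothParityTernary` in the smoothed circle method for the `y`-friable solutions of `d₁ n₁ + σ d₂ n₂ = n₃` (`σ = ±1`,
`n₁, n₂` ODD, `n₃` free) with `W`-class profile weights `p_{c_i}(n_i/X_i)` at three scales `X₁, X₂, X₃` ([Harper2016, §5]: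
friable solutions of `a + b = c` are counted by `∫₀¹ F G conj K`, the minor arcs being handled by Theorem 2 (restriction)
and Hölder's inequality).  With the profile sums (`SmoothProfileSums`)
`V₁(θ) = classProfileSum X₁ y 2 1 c₁ θ`, `V₂(θ) = classProfileSum X₂ y 2 1 c₂ θ`, `V₃(θ) = classProfileSum X₃ y 1 0 c₃ θ`
sampled at the `N₀` points `θ = r/N₀` with the dilations `d₁`, `σ d₂`, `1`, i.e. the summand
`F(r) = V₁(d₁ r/N₀) · V₂(σ d₂ r/N₀) · conj V₃(r/N₀)`:

* `parity_circle_split` (pure algebra): if `d₁X₁ + d₂X₂ + X₃ < N₀` then for EVERY finite `Maj ⊆ [0, N₀)`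
  `N₀ · parityTernarySum = Σ_{r ∈ Maj} F(r) + Σ_{r ∈ [0, N₀) \ Maj} F(r)`
  (`ternary_circle_identity_finset` at the shift `t = 0` with `d₃ = 1` and the weights `p_{c_i}(n/X_i)` on the
  parity-filtered friable sets, then `Finset.sum_sdiff`);
* `parity_minor_arcs_of_minor` (THE MINOR ARCS): in Harper's regime at each of the three scales (`X_i ≥ x₀`,
  `(log X_i)^8 ≤ y`, `log y ≤ ½ (log X_i)^{1/6}`, `y^{200} ≤ X_i`, `α(X_i, y) ≥ 1 − 10⁻⁴`, `Ψ(X_i, y) ≥ X_i^{39999/40000}`) and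
  `(log 2X₃)^8 ≤ y`, for `(d₁, N₀) = (d₂, N₀) = 1`, `|p_{c_i}| ≤ 1`, `‖c₃‖_W < ∞`, `1 ≤ R ≤ (2X₃)^{1/10}` and every
  `T ⊆ [0, N₀)` all of whose points `θ = r/N₀` have `|θ − a/q| > R/X₃` for all `1 ≤ q ≤ R`, `a ∈ ℤ`:
  `‖Σ_{r ∈ T} F(r)‖ ≤ C (log X₁ log X₂ log X₃)⁸ (1+N₀/X₁)^{2/5} (1+N₀/X₂)^{2/5} (1+N₀/X₃)^{1/5}`
  `· 𝓟(X₁) 𝓟(X₂) 𝓟(X₃)^{1/2} S₃^{1/2}`,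
  `𝓟(X) = X^{α} ζ(α, y)/√φ₂(α, y)` (`α = α(X, y)`), with the free variable's minor-arc supremum
  `S₃ = B(2X₃, R) Σ_ℓ ‖c₃ ℓ‖ + 24 𝓟(2X₃) ‖c₃‖_W / R³`,
  `B(x, R) = C (log x)³ y^{5/2(1−α)} R^{−1/2+3/2(1−α)} 𝓟(x) + 164 (1 + log x)² y² x^{9/10} + 64 x/R³ + 1`
  — `ternary_holder_restriction` with the coefficients `a_i(n) = 1_{odd}(n) p_{c_i}(n/X_i)` (`i = 1, 2`),
  `a₃(n) = p_{c₃}(n/X₃)` and the dilations `d₁, σd₂, 1`, the supremum from `norm_classProfileSum_free_le_of_minor` at the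
  ambient scale `x' = 2X₃` (its radius `2R/x'` is `R/X₃`);
* `parity_minor_arcs`: the same at `X₃ = x/e₃` with `1 ≤ e₃ ≤ 96`, for points that are minor at the radius `96R/x (≥ R/X₃)`
  used for the major arcs with moduli `k ≤ R`;
* `minor_of_forall_coprime`: a point `θ ∈ [0, 1)` at distance `> ρ` from every REDUCED fraction `a/k` with
  `0 ≤ a ≤ k ≤ R` is at distance `> ρ` from every fraction `a/q`, `1 ≤ q ≤ R`, `a ∈ ℤ`, provided `ρR < 1` — so the
  complement in `[0, N₀)` of a major set cut out by the reduced fractions `a/k ∈ [0, 1]` (INCLUDING `1/1`: the sample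
  points `r/N₀` just below `1` are major) satisfies the hypothesis of `parity_minor_arcs`.

Design: the major set is an arbitrary `Maj`/`T` here, so that these two pieces fit any labelling of the major arcs;
the helper identities `classProfileSum_two_one_eq_sum_ite` / `classProfileSum_one_zero_eq_sum` put the profile sums in
the shape `Σ_{n ∈ S(X, y)} a(n) e(nθ)` of the restriction estimate.  Not here: the major arcs (companion file) and the
final `ε`-form of the zeroth-order asymptotic `ParityTernaryAsymptotic`.

## References

* A. J. Harper, *Minor arcs, mean values, and restriction theory for exponential sums over smooth numbers*,
  Compositio Math. 152 (2016) 1121–1158, Theorems 1, 2 and §5 [Harper2016].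
-/

noncomputable section

open Finset Real Complex
open scoped FourierTransform

namespace Literature.NumberTheory.Sieve

namespace SmoothArcs

open TwistedWeight

/-! ### The profile sums as plain weighted exponential sums over `S(X, y)` -/

/-- The class `n ≡ 1 (mod 2)` of `classProfileSum X y 2 1` is the class of odd `n`. [folklore] -/
theorem filter_modEq_two_one_eq_filter_odd (S : Finset ℕ) :
    S.filter (fun n => n ≡ 1 [MOD 2]) = S.filter (fun n => Odd n) :=
  Finset.filter_congr fun n _ => by rw [Nat.odd_iff, Nat.ModEq]

/-- `classProfileSum X y 2 1 c θ` is the sum over the ODD members of `S(X, y)`. [folklore] -/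
theorem classProfileSum_two_one_eq_sum_odd (X : ℝ) (y : ℕ) (c : ℤ → ℂ) (θ : ℝ) :
    classProfileSum X y 2 1 c θ = ∑ n ∈ (Nat.smoothNumbersUpTo ⌊X⌋₊ (y + 1)).filter (fun n => Odd n),
      profileFn c (n / X) * (𝐞 ((n : ℝ) * θ) : ℂ) := by
  rw [classProfileSum, filter_modEq_two_one_eq_filter_odd]

/-- `classProfileSum X y 2 1 c θ = Σ_{n ∈ S(X,y)} a(n) e(nθ)` with the coefficients `a(n) = 1_{odd}(n) p_c(n/X)` (the shape
of the restriction estimate). [folklore] -/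
theorem classProfileSum_two_one_eq_sum_ite (X : ℝ) (y : ℕ) (c : ℤ → ℂ) (θ : ℝ) :
    classProfileSum X y 2 1 c θ = ∑ n ∈ Nat.smoothNumbersUpTo ⌊X⌋₊ (y + 1),
      (if Odd n then profileFn c (n / X) else 0) * (𝐞 ((n : ℝ) * θ) : ℂ) := by
  rw [classProfileSum_two_one_eq_sum_odd, Finset.sum_filter]
  refine Finset.sum_congr rfl fun n _ => ?_
  split_ifs <;> simp

/-- `classProfileSum X y 1 0 c θ = Σ_{n ∈ S(X,y)} p_c(n/X) e(nθ)` (no class condition). [folklore] -/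
theorem classProfileSum_one_zero_eq_sum (X : ℝ) (y : ℕ) (c : ℤ → ℂ) (θ : ℝ) :
    classProfileSum X y 1 0 c θ =
      ∑ n ∈ Nat.smoothNumbersUpTo ⌊X⌋₊ (y + 1), profileFn c (n / X) * (𝐞 ((n : ℝ) * θ) : ℂ) := by
  rw [classProfileSum, Finset.filter_true_of_mem (fun n _ => (Nat.modEq_one : n ≡ 0 [MOD 1]))]

/-- The coefficients `1_{odd}(n) p_c(n/X)` have norm `≤ 1` when `|p_c| ≤ 1`. [folklore] -/
theorem norm_ite_profileFn_le_one {c : ℤ → ℂ} (hp : ∀ v : ℝ, ‖profileFn c v‖ ≤ 1) (X : ℝ) (n : ℕ) :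
    ‖(if Odd n then profileFn c (n / X) else 0 : ℂ)‖ ≤ 1 := by
  split_ifs
  · exact hp _
  · simp

/-! ### (A) The circle split -/

/-- **The circle split of the parity-class friable ternary count.** For `σ = ±1`, `X_i ≥ 0` with
`d₁X₁ + d₂X₂ + X₃ < N₀` (no wrap-around modulo `N₀`; in particular `N₀ ≠ 0`) and EVERY `Maj ⊆ [0, N₀)`:
`N₀ · parityTernarySum y σ d₁ d₂ X₁ X₂ X₃ c₁ c₂ c₃ = Σ_{r ∈ Maj} F(r) + Σ_{r ∈ [0,N₀) \ Maj} F(r)`,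
`F(r) = V₁(d₁r/N₀) V₂(σd₂r/N₀) conj V₃(r/N₀)`, `V₁ = classProfileSum X₁ y 2 1 c₁`, `V₂ = classProfileSum X₂ y 2 1 c₂`,
`V₃ = classProfileSum X₃ y 1 0 c₃`.  The discrete circle identity `ternary_circle_identity_finset` (shift `t = 0`, `d₃ = 1`,
weights `p_{c_i}(n/X_i)` on the odd resp. all members of `S(X_i, y)`) followed by `Σ_{[0,N₀)} = Σ_{Maj} + Σ_{[0,N₀) \ Maj}`.
[cite: Harper2016, §5] -/
theorem parity_circle_split {N₀ : ℕ} (y : ℕ) {σ : ℤ} (hσ : σ = 1 ∨ σ = -1) (d₁ d₂ : ℕ)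
    {X₁ X₂ X₃ : ℝ} (hX₁ : 0 ≤ X₁) (hX₂ : 0 ≤ X₂) (hX₃ : 0 ≤ X₃)
    (hwrap : (d₁ : ℝ) * X₁ + d₂ * X₂ + X₃ < N₀) (c₁ c₂ c₃ : ℤ → ℂ) {Maj : Finset ℕ}
    (hMaj : Maj ⊆ Finset.range N₀) :
    (N₀ : ℂ) * parityTernarySum y σ d₁ d₂ X₁ X₂ X₃ c₁ c₂ c₃ =
      ∑ r ∈ Maj, classProfileSum X₁ y 2 1 c₁ ((d₁ : ℝ) * r / N₀) *
          classProfileSum X₂ y 2 1 c₂ ((σ : ℝ) * d₂ * r / N₀) *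
          starRingEnd ℂ (classProfileSum X₃ y 1 0 c₃ ((r : ℝ) / N₀)) +
      ∑ r ∈ Finset.range N₀ \ Maj, classProfileSum X₁ y 2 1 c₁ ((d₁ : ℝ) * r / N₀) *
          classProfileSum X₂ y 2 1 c₂ ((σ : ℝ) * d₂ * r / N₀) *
          starRingEnd ℂ (classProfileSum X₃ y 1 0 c₃ ((r : ℝ) / N₀)) := by
  rw [add_comm, Finset.sum_sdiff hMaj]
  have hN : N₀ ≠ 0 := by
    rintro rfl
    have h0 : (0 : ℝ) ≤ (d₁ : ℝ) * X₁ + d₂ * X₂ + X₃ := by positivity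
    rw [Nat.cast_zero] at hwrap
    linarith
  -- no wrap-around in `ℕ`
  have hwrap' : d₁ * ⌊X₁⌋₊ + d₂ * ⌊X₂⌋₊ + 1 * ⌊X₃⌋₊ < N₀ := by
    have h1 : (d₁ : ℝ) * ⌊X₁⌋₊ ≤ d₁ * X₁ := mul_le_mul_of_nonneg_left (Nat.floor_le hX₁) (Nat.cast_nonneg _)
    have h2 : (d₂ : ℝ) * ⌊X₂⌋₊ ≤ d₂ * X₂ := mul_le_mul_of_nonneg_left (Nat.floor_le hX₂) (Nat.cast_nonneg _)
    have h3 : ((⌊X₃⌋₊ : ℕ) : ℝ) ≤ X₃ := Nat.floor_le hX₃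
    have h : ((d₁ * ⌊X₁⌋₊ + d₂ * ⌊X₂⌋₊ + 1 * ⌊X₃⌋₊ : ℕ) : ℝ) < N₀ := by push_cast; linarith
    exact_mod_cast h
  have hS : ∀ {X : ℝ} {n : ℕ}, n ∈ (Nat.smoothNumbersUpTo ⌊X⌋₊ (y + 1)).filter (fun n => Odd n) → n ≤ ⌊X⌋₊ :=
    fun hn => (Nat.mem_smoothNumbersUpTo.mp (Finset.mem_filter.mp hn).1).1
  have h := ternary_circle_identity_finset hN (S₃ := Nat.smoothNumbersUpTo ⌊X₃⌋₊ (y + 1))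
    (fun n hn => hS hn) (fun n hn => hS hn) (fun n hn => (Nat.mem_smoothNumbersUpTo.mp hn).1) d₁ d₂ 1 σ hσ
    hwrap' (fun n => profileFn c₁ (n / X₁)) (fun n => profileFn c₂ (n / X₂)) (fun n => profileFn c₃ (n / X₃)) 0
  simp only [add_zero, Nat.cast_one, one_mul] at h
  unfold parityTernarySum
  rw [← h]
  refine Finset.sum_congr rfl fun r _ => ?_
  rw [classProfileSum_two_one_eq_sum_odd, classProfileSum_two_one_eq_sum_odd, classProfileSum_one_zero_eq_sum]
  simp only [mul_div_assoc]

/-! ### (B) The minor arcs -/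

/-- **Minor-arc bound for the parity-class ternary product of friable profile sums.** With
`𝓟(X) = X^α ζ(α,y)/√φ₂(α,y)` (`α = α(X, y)`), `V₁ = classProfileSum X₁ y 2 1 c₁`, `V₂ = classProfileSum X₂ y 2 1 c₂`,
`V₃ = classProfileSum X₃ y 1 0 c₃`: in Harper's regime at the three scales `X₁, X₂, X₃` and with `(log 2X₃)^8 ≤ y`, for
`N₀ ≥ 1`, `σ = ±1`, `(d₁, N₀) = (d₂, N₀) = 1`, `1 ≤ R ≤ (2X₃)^{1/10}`, profiles with `|p_{c_i}| ≤ 1` and `‖c₃‖_W < ∞`, every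
`T ⊆ [0, N₀)` whose points satisfy `|r/N₀ − a/q| > R/X₃` for all `1 ≤ q ≤ R`, `a ∈ ℤ`:
`‖Σ_{r ∈ T} V₁(d₁r/N₀) V₂(σd₂r/N₀) conj V₃(r/N₀)‖ ≤ C (log X₁ log X₂ log X₃)⁸ (1+N₀/X₁)^{2/5} (1+N₀/X₂)^{2/5}`
`· (1+N₀/X₃)^{1/5} 𝓟(X₁) 𝓟(X₂) 𝓟(X₃)^{1/2} S₃^{1/2}`, `S₃ = B(2X₃, R) Σ_ℓ ‖c₃ ℓ‖ + 24 𝓟(2X₃) ‖c₃‖_W/R³`,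
`B(x, R) = C (log x)³ y^{5/2(1−α)} R^{−1/2+3/2(1−α)} 𝓟(x) + 164 (1 + log x)² y² x^{9/10} + 64 x/R³ + 1` (`α = α(x, y)`).
Proof: Hölder `(5/2, 5/2, 5)` and oversampled restriction (`ternary_holder_restriction`, coefficients
`1_{odd}(n) p_{c_i}(n/X_i)`, `p_{c₃}(n/X₃)`, dilations `d₁, σd₂, 1`) with the supremum of the free factor from
`norm_classProfileSum_free_le_of_minor` at the ambient scale `2X₃` (radius `2R/(2X₃) = R/X₃`).
[cite: Harper2016, Theorems 1, 2 and §5] -/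
theorem parity_minor_arcs_of_minor :
    ∃ C x₀ : ℝ, 0 < C ∧ ∀ (y : ℕ) (X₁ X₂ X₃ : ℝ),
      x₀ ≤ X₁ → Real.log X₁ ^ 8 ≤ (y : ℝ) → Real.log (y : ℝ) ≤ 1 / 2 * Real.log X₁ ^ (1 / 6 : ℝ) →
      (y : ℝ) ^ 200 ≤ X₁ → 1 - 1 / 10000 ≤ saddlePoint X₁ y →
      X₁ ^ ((39999 : ℝ) / 40000) ≤ ((Nat.smoothNumbersUpTo ⌊X₁⌋₊ (y + 1)).card : ℝ) →
      x₀ ≤ X₂ → Real.log X₂ ^ 8 ≤ (y : ℝ) → Real.log (y : ℝ) ≤ 1 / 2 * Real.log X₂ ^ (1 / 6 : ℝ) →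
      (y : ℝ) ^ 200 ≤ X₂ → 1 - 1 / 10000 ≤ saddlePoint X₂ y →
      X₂ ^ ((39999 : ℝ) / 40000) ≤ ((Nat.smoothNumbersUpTo ⌊X₂⌋₊ (y + 1)).card : ℝ) →
      x₀ ≤ X₃ → Real.log X₃ ^ 8 ≤ (y : ℝ) → Real.log (y : ℝ) ≤ 1 / 2 * Real.log X₃ ^ (1 / 6 : ℝ) →
      (y : ℝ) ^ 200 ≤ X₃ → 1 - 1 / 10000 ≤ saddlePoint X₃ y →
      X₃ ^ ((39999 : ℝ) / 40000) ≤ ((Nat.smoothNumbersUpTo ⌊X₃⌋₊ (y + 1)).card : ℝ) →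
      Real.log (2 * X₃) ^ 8 ≤ (y : ℝ) →
      ∀ (N₀ : ℕ), 1 ≤ N₀ → ∀ (σ : ℤ), (σ = 1 ∨ σ = -1) → ∀ (d₁ d₂ : ℕ), IsCoprime (d₁ : ℤ) N₀ →
      IsCoprime (d₂ : ℤ) N₀ → ∀ (R : ℝ), 1 ≤ R → R ≤ (2 * X₃) ^ (1 / 10 : ℝ) →
      ∀ (c₁ c₂ c₃ : ℤ → ℂ), (∀ v : ℝ, ‖profileFn c₁ v‖ ≤ 1) → (∀ v : ℝ, ‖profileFn c₂ v‖ ≤ 1) →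
      (∀ v : ℝ, ‖profileFn c₃ v‖ ≤ 1) → Summable (fun ℓ : ℤ => ‖c₃ ℓ‖ * (1 + |(ℓ : ℝ)|) ^ 3) →
      ∀ (T : Finset ℕ), T ⊆ Finset.range N₀ →
      (∀ r ∈ T, ∀ q : ℕ, 1 ≤ q → (q : ℝ) ≤ R → ∀ a : ℤ, R / X₃ < |(r : ℝ) / N₀ - a / q|) →
        ‖∑ r ∈ T, classProfileSum X₁ y 2 1 c₁ ((d₁ : ℝ) * r / N₀) *
            classProfileSum X₂ y 2 1 c₂ ((σ : ℝ) * d₂ * r / N₀) *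
            starRingEnd ℂ (classProfileSum X₃ y 1 0 c₃ ((r : ℝ) / N₀))‖ ≤
          C * (Real.log X₁ * Real.log X₂ * Real.log X₃) ^ (8 : ℕ) *
            (1 + (N₀ : ℝ) / X₁) ^ (2 / 5 : ℝ) * (1 + (N₀ : ℝ) / X₂) ^ (2 / 5 : ℝ) *
            (1 + (N₀ : ℝ) / X₃) ^ (1 / 5 : ℝ) *
            (X₁ ^ saddlePoint X₁ y *
              (smoothZeta (saddlePoint X₁ y) y / Real.sqrt (saddlePhi₂ (saddlePoint X₁ y) y))) *
            (X₂ ^ saddlePoint X₂ y *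
              (smoothZeta (saddlePoint X₂ y) y / Real.sqrt (saddlePhi₂ (saddlePoint X₂ y) y))) *
            (X₃ ^ saddlePoint X₃ y *
              (smoothZeta (saddlePoint X₃ y) y / Real.sqrt (saddlePhi₂ (saddlePoint X₃ y) y))) ^ (1 / 2 : ℝ) *
            ((C * Real.log (2 * X₃) ^ 3 * (y : ℝ) ^ (5 / 2 * (1 - saddlePoint (2 * X₃) y)) *
                  R ^ (-(1 / 2 : ℝ) + 3 / 2 * (1 - saddlePoint (2 * X₃) y)) *
                  ((2 * X₃) ^ saddlePoint (2 * X₃) y * (smoothZeta (saddlePoint (2 * X₃) y) y /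
                    Real.sqrt (saddlePhi₂ (saddlePoint (2 * X₃) y) y))) +
                164 * (1 + Real.log (2 * X₃)) ^ 2 * (y : ℝ) ^ 2 * (2 * X₃) ^ (9 / 10 : ℝ) +
                64 * (2 * X₃) / R ^ 3 + 1) * (∑' ℓ : ℤ, ‖c₃ ℓ‖) +
              24 * ((2 * X₃) ^ saddlePoint (2 * X₃) y * (smoothZeta (saddlePoint (2 * X₃) y) y /
                Real.sqrt (saddlePhi₂ (saddlePoint (2 * X₃) y) y))) * profileNorm c₃ / R ^ 3) ^ (1 / 2 : ℝ) := by
  obtain ⟨C_H, x_H, hC_H, hH⟩ := ternary_holder_restriction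
  obtain ⟨C_M, x_M, hC_M, hM⟩ := norm_classProfileSum_free_le_of_minor
  refine ⟨max C_H C_M, max (max x_H x_M) 2, lt_max_of_lt_left hC_H, ?_⟩
  intro y X₁ X₂ X₃ hx₁ hy8₁ hy6₁ hy200₁ hα₁ hΨ₁ hx₂ hy8₂ hy6₂ hy200₂ hα₂ hΨ₂ hx₃ hy8₃ hy6₃ hy200₃ hα₃ hΨ₃
    hy8₃' N₀ hN₀ σ hσ d₁ d₂ hd₁ hd₂ R hR1 hRX c₁ c₂ c₃ hp₁ hp₂ hp₃ hc₃ T hT hminor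
  simp only [max_le_iff] at hx₁ hx₂ hx₃
  obtain ⟨⟨hxH₁, -⟩, h2₁⟩ := hx₁
  obtain ⟨⟨hxH₂, -⟩, h2₂⟩ := hx₂
  obtain ⟨⟨hxH₃, hxM₃⟩, h2₃⟩ := hx₃
  have hX₃0 : 0 < X₃ := by linarith
  have hR0 : 0 < R := by linarith
  -- `y ≥ 2` (else `α(X₃, y) = 0`)
  have hy2 : 2 ≤ y := by
    by_contra hlt
    rw [saddlePoint_of_not (fun h => hlt h.2)] at hα₃
    norm_num at hα₃
  have hy1 : (1 : ℝ) ≤ y := by exact_mod_cast (by omega : 1 ≤ y)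
  -- positivity of the data at the scales (atoms for `positivity`)
  have hX₁0 : 0 < X₁ := by linarith
  have hX₂0 : 0 < X₂ := by linarith
  have hζ₁ : 0 < smoothZeta (saddlePoint X₁ y) y := smoothZeta_pos (saddlePoint_pos (by linarith) hy2)
  have hζ₂ : 0 < smoothZeta (saddlePoint X₂ y) y := smoothZeta_pos (saddlePoint_pos (by linarith) hy2)
  have hζ₃ : 0 < smoothZeta (saddlePoint X₃ y) y := smoothZeta_pos (saddlePoint_pos (by linarith) hy2)
  have hζ' : 0 < smoothZeta (saddlePoint (2 * X₃) y) y := smoothZeta_pos (saddlePoint_pos (by linarith) hy2)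
  have hL' : 0 ≤ Real.log (2 * X₃) := Real.log_nonneg (by linarith)
  have hsum₃ : 0 ≤ ∑' ℓ : ℤ, ‖c₃ ℓ‖ := tsum_nonneg fun _ => norm_nonneg _
  have hpN : 0 ≤ profileNorm c₃ := profileNorm_nonneg c₃
  -- the regime of the minor-arc lemma at the ambient scale `2X₃`
  have hy6' : Real.log (y : ℝ) ≤ 1 / 2 * Real.log (2 * X₃) ^ (1 / 6 : ℝ) :=
    hy6₃.trans (mul_le_mul_of_nonneg_left (Real.rpow_le_rpow (Real.log_nonneg (by linarith))
      (Real.log_le_log hX₃0 (by linarith)) (by norm_num)) (by norm_num))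
  have hy80' : (y : ℝ) ^ 80 ≤ 2 * X₃ :=
    ((pow_le_pow_right₀ hy1 (by norm_num : 80 ≤ 200)).trans hy200₃).trans (by linarith)
  -- `σ d₂` is coprime to `N₀`
  have hd₂' : IsCoprime (σ * (d₂ : ℤ)) (N₀ : ℤ) := by
    rcases hσ with rfl | rfl
    · simpa using hd₂
    · simpa using hd₂.neg_left
  -- the supremum of the free factor on `T`
  have hsup : ∀ r ∈ T, ‖∑ n ∈ Nat.smoothNumbersUpTo ⌊X₃⌋₊ (y + 1),
      profileFn c₃ (n / X₃) * (𝐞 ((n : ℝ) * (((1 : ℤ) * r : ℝ) / N₀)) : ℂ)‖ ≤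
      (max C_H C_M * Real.log (2 * X₃) ^ 3 * (y : ℝ) ^ (5 / 2 * (1 - saddlePoint (2 * X₃) y)) *
            R ^ (-(1 / 2 : ℝ) + 3 / 2 * (1 - saddlePoint (2 * X₃) y)) *
            ((2 * X₃) ^ saddlePoint (2 * X₃) y * (smoothZeta (saddlePoint (2 * X₃) y) y /
              Real.sqrt (saddlePhi₂ (saddlePoint (2 * X₃) y) y))) +
          164 * (1 + Real.log (2 * X₃)) ^ 2 * (y : ℝ) ^ 2 * (2 * X₃) ^ (9 / 10 : ℝ) +
          64 * (2 * X₃) / R ^ 3 + 1) * (∑' ℓ : ℤ, ‖c₃ ℓ‖) +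
        24 * ((2 * X₃) ^ saddlePoint (2 * X₃) y * (smoothZeta (saddlePoint (2 * X₃) y) y /
          Real.sqrt (saddlePhi₂ (saddlePoint (2 * X₃) y) y))) * profileNorm c₃ / R ^ 3 := by
    intro r hr
    rw [Int.cast_one, one_mul, ← classProfileSum_one_zero_eq_sum]
    have hmin : ∀ q : ℕ, 1 ≤ q → (q : ℝ) ≤ R → ∀ a : ℤ, 2 * R / (2 * X₃) < |(r : ℝ) / N₀ - a / q| := by
      intro q hq hqR a
      rw [mul_div_mul_left R X₃ two_ne_zero]
      exact hminor r hr q hq hqR a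
    refine (hM (2 * X₃) y (by linarith) hy8₃' hy6' hy80' X₃ (by linarith) (by linarith) R hR1 hRX c₃ hc₃ _
      hmin).trans ?_
    gcongr
    exact le_max_right _ _
  -- Hölder and restriction
  have hHT := hH y X₁ X₂ X₃ hxH₁ hy8₁ hy6₁ hy200₁ hα₁ hΨ₁ hxH₂ hy8₂ hy6₂ hy200₂ hα₂ hΨ₂ hxH₃ hy8₃ hy6₃ hy200₃
    hα₃ hΨ₃ N₀ hN₀ (d₁ : ℤ) (σ * (d₂ : ℤ)) 1 hd₁ hd₂' isCoprime_one_left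
    (fun n => if Odd n then profileFn c₁ (n / X₁) else 0) (fun n => if Odd n then profileFn c₂ (n / X₂) else 0)
    (fun n => profileFn c₃ (n / X₃)) (norm_ite_profileFn_le_one hp₁ X₁) (norm_ite_profileFn_le_one hp₂ X₂)
    (fun n => hp₃ _) T hT _ (by positivity) hsup
  simp only [Int.cast_natCast, Int.cast_mul, Int.cast_one, one_mul] at hHT
  refine (norm_sum_le _ _).trans ?_
  simp only [norm_mul, Complex.norm_conj, classProfileSum_two_one_eq_sum_ite, classProfileSum_one_zero_eq_sum]
  refine hHT.trans ?_
  gcongr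
  exact le_max_left _ _

/-- **Minor arcs of the parity-class ternary count, in the conventions of the major arcs.** As
`parity_minor_arcs_of_minor` with the third scale `X₃ = x/e₃`, `1 ≤ e₃ ≤ 96`, for every `T ⊆ [0, N₀)` whose points are
minor at the radius `96R/x` of the major arcs with moduli `k ≤ R`: `|r/N₀ − a/q| > 96R/x` for all `1 ≤ q ≤ R`, `a ∈ ℤ`
(then `|r/N₀ − a/q| > R/X₃ = e₃R/x`).  Typical use: `T = [0, N₀) \ Maj` in `parity_circle_split`, the minor property of
its points being supplied by `minor_of_forall_coprime` when `Maj` is cut out by the reduced fractions `a/k ∈ [0, 1]`,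
`k ≤ R`. [cite: Harper2016, Theorems 1, 2 and §5] -/
theorem parity_minor_arcs :
    ∃ C x₀ : ℝ, 0 < C ∧ ∀ (x : ℝ) (y e₃ : ℕ) (X₁ X₂ : ℝ), 1 ≤ e₃ → e₃ ≤ 96 →
      x₀ ≤ X₁ → Real.log X₁ ^ 8 ≤ (y : ℝ) → Real.log (y : ℝ) ≤ 1 / 2 * Real.log X₁ ^ (1 / 6 : ℝ) →
      (y : ℝ) ^ 200 ≤ X₁ → 1 - 1 / 10000 ≤ saddlePoint X₁ y →
      X₁ ^ ((39999 : ℝ) / 40000) ≤ ((Nat.smoothNumbersUpTo ⌊X₁⌋₊ (y + 1)).card : ℝ) →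
      x₀ ≤ X₂ → Real.log X₂ ^ 8 ≤ (y : ℝ) → Real.log (y : ℝ) ≤ 1 / 2 * Real.log X₂ ^ (1 / 6 : ℝ) →
      (y : ℝ) ^ 200 ≤ X₂ → 1 - 1 / 10000 ≤ saddlePoint X₂ y →
      X₂ ^ ((39999 : ℝ) / 40000) ≤ ((Nat.smoothNumbersUpTo ⌊X₂⌋₊ (y + 1)).card : ℝ) →
      x₀ ≤ x / e₃ → Real.log (x / e₃) ^ 8 ≤ (y : ℝ) → Real.log (y : ℝ) ≤ 1 / 2 * Real.log (x / e₃) ^ (1 / 6 : ℝ) →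
      (y : ℝ) ^ 200 ≤ x / e₃ → 1 - 1 / 10000 ≤ saddlePoint (x / e₃) y →
      (x / e₃) ^ ((39999 : ℝ) / 40000) ≤ ((Nat.smoothNumbersUpTo ⌊x / e₃⌋₊ (y + 1)).card : ℝ) →
      Real.log (2 * (x / e₃)) ^ 8 ≤ (y : ℝ) →
      ∀ (N₀ : ℕ), 1 ≤ N₀ → ∀ (σ : ℤ), (σ = 1 ∨ σ = -1) → ∀ (d₁ d₂ : ℕ), IsCoprime (d₁ : ℤ) N₀ →
      IsCoprime (d₂ : ℤ) N₀ → ∀ (R : ℝ), 1 ≤ R → R ≤ (2 * (x / e₃)) ^ (1 / 10 : ℝ) →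
      ∀ (c₁ c₂ c₃ : ℤ → ℂ), (∀ v : ℝ, ‖profileFn c₁ v‖ ≤ 1) → (∀ v : ℝ, ‖profileFn c₂ v‖ ≤ 1) →
      (∀ v : ℝ, ‖profileFn c₃ v‖ ≤ 1) → Summable (fun ℓ : ℤ => ‖c₃ ℓ‖ * (1 + |(ℓ : ℝ)|) ^ 3) →
      ∀ (T : Finset ℕ), T ⊆ Finset.range N₀ →
      (∀ r ∈ T, ∀ q : ℕ, 1 ≤ q → (q : ℝ) ≤ R → ∀ a : ℤ, 96 * R / x < |(r : ℝ) / N₀ - a / q|) →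
        ‖∑ r ∈ T, classProfileSum X₁ y 2 1 c₁ ((d₁ : ℝ) * r / N₀) *
            classProfileSum X₂ y 2 1 c₂ ((σ : ℝ) * d₂ * r / N₀) *
            starRingEnd ℂ (classProfileSum (x / e₃) y 1 0 c₃ ((r : ℝ) / N₀))‖ ≤
          C * (Real.log X₁ * Real.log X₂ * Real.log (x / e₃)) ^ (8 : ℕ) *
            (1 + (N₀ : ℝ) / X₁) ^ (2 / 5 : ℝ) * (1 + (N₀ : ℝ) / X₂) ^ (2 / 5 : ℝ) *
            (1 + (N₀ : ℝ) / (x / e₃)) ^ (1 / 5 : ℝ) *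
            (X₁ ^ saddlePoint X₁ y *
              (smoothZeta (saddlePoint X₁ y) y / Real.sqrt (saddlePhi₂ (saddlePoint X₁ y) y))) *
            (X₂ ^ saddlePoint X₂ y *
              (smoothZeta (saddlePoint X₂ y) y / Real.sqrt (saddlePhi₂ (saddlePoint X₂ y) y))) *
            ((x / e₃) ^ saddlePoint (x / e₃) y * (smoothZeta (saddlePoint (x / e₃) y) y /
              Real.sqrt (saddlePhi₂ (saddlePoint (x / e₃) y) y))) ^ (1 / 2 : ℝ) *
            ((C * Real.log (2 * (x / e₃)) ^ 3 * (y : ℝ) ^ (5 / 2 * (1 - saddlePoint (2 * (x / e₃)) y)) *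
                  R ^ (-(1 / 2 : ℝ) + 3 / 2 * (1 - saddlePoint (2 * (x / e₃)) y)) *
                  ((2 * (x / e₃)) ^ saddlePoint (2 * (x / e₃)) y * (smoothZeta (saddlePoint (2 * (x / e₃)) y) y /
                    Real.sqrt (saddlePhi₂ (saddlePoint (2 * (x / e₃)) y) y))) +
                164 * (1 + Real.log (2 * (x / e₃))) ^ 2 * (y : ℝ) ^ 2 * (2 * (x / e₃)) ^ (9 / 10 : ℝ) +
                64 * (2 * (x / e₃)) / R ^ 3 + 1) * (∑' ℓ : ℤ, ‖c₃ ℓ‖) +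
              24 * ((2 * (x / e₃)) ^ saddlePoint (2 * (x / e₃)) y * (smoothZeta (saddlePoint (2 * (x / e₃)) y) y /
                Real.sqrt (saddlePhi₂ (saddlePoint (2 * (x / e₃)) y) y))) * profileNorm c₃ / R ^ 3) ^
              (1 / 2 : ℝ) := by
  obtain ⟨C, x₀, hC, h⟩ := parity_minor_arcs_of_minor
  refine ⟨C, max x₀ 1, hC, ?_⟩
  intro x y e₃ X₁ X₂ he₃ he96 hx₁ hy8₁ hy6₁ hy200₁ hα₁ hΨ₁ hx₂ hy8₂ hy6₂ hy200₂ hα₂ hΨ₂ hx₃ hy8₃ hy6₃ hy200₃ hα₃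
    hΨ₃ hy8₃' N₀ hN₀ σ hσ d₁ d₂ hd₁ hd₂ R hR1 hRX c₁ c₂ c₃ hp₁ hp₂ hp₃ hc₃ T hT hminor
  rw [max_le_iff] at hx₁ hx₂ hx₃
  have he0 : (0 : ℝ) < e₃ := by exact_mod_cast he₃
  have he96' : (e₃ : ℝ) ≤ 96 := by exact_mod_cast he96
  have hR0 : 0 ≤ R := by linarith
  have hx0 : 0 < x := by
    have h1 := (le_div_iff₀ he0).mp hx₃.2
    linarith
  refine h y X₁ X₂ (x / e₃) hx₁.1 hy8₁ hy6₁ hy200₁ hα₁ hΨ₁ hx₂.1 hy8₂ hy6₂ hy200₂ hα₂ hΨ₂ hx₃.1 hy8₃ hy6₃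
    hy200₃ hα₃ hΨ₃ hy8₃' N₀ hN₀ σ hσ d₁ d₂ hd₁ hd₂ R hR1 hRX c₁ c₂ c₃ hp₁ hp₂ hp₃ hc₃ T hT
    (fun r hr q hq hqR a => lt_of_le_of_lt ?_ (hminor r hr q hq hqR a))
  -- `R/(x/e₃) = e₃R/x ≤ 96R/x`
  rw [div_div_eq_mul_div]
  exact div_le_div_of_nonneg_right (by nlinarith) hx0.le

/-! ### From reduced fractions in `[0, 1]` to all fractions -/

/-- **Minor points via reduced fractions.** If `θ ∈ [0, 1)` has `|θ − a/k| > ρ` for every REDUCED fraction `a/k` with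
`1 ≤ k ≤ R`, `0 ≤ a ≤ k` (so including `0/1` and `1/1`), and `ρR < 1`, then `|θ − a/q| > ρ` for every `1 ≤ q ≤ R` and
every `a ∈ ℤ`: reduce `a/q` to lowest terms `a'/k`, `k ∣ q`; if `a' < 0` or `a' > k` then `|θ − a'/k| ≥ 1/k ≥ 1/R > ρ`.
(Hence the complement of a major set labelled by the reduced fractions of `[0, 1]` with denominators `≤ R` at radius
`ρ < 1/R` consists of minor points in the sense of `parity_minor_arcs`.) [folklore] -/
theorem minor_of_forall_coprime {R : ℕ} {ρ θ : ℝ} (hθ0 : 0 ≤ θ) (hθ1 : θ < 1) (hρ : ρ * R < 1)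
    (h : ∀ k : ℕ, 1 ≤ k → k ≤ R → ∀ a : ℕ, a ≤ k → Nat.Coprime a k → ρ < |θ - a / k|) :
    ∀ q : ℕ, 1 ≤ q → (q : ℝ) ≤ R → ∀ a : ℤ, ρ < |θ - a / q| := by
  intro q hq hqR a
  have hqR' : q ≤ R := by exact_mod_cast hqR
  have hR0 : (0 : ℝ) < R := by exact_mod_cast lt_of_lt_of_le hq hqR'
  have hρ' : ρ < 1 / R := by rw [lt_div_iff₀ hR0]; exact hρ
  -- the reduced fraction `Q = a/q = Q.num/Q.den`, `Q.den ∣ q`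
  set Q : ℚ := (a : ℚ) / (q : ℚ) with hQ
  have hden : Q.den ∣ q := by
    have h1 := Rat.den_dvd a q
    rw [Rat.divInt_eq_div] at h1
    push_cast at h1
    exact Int.natCast_dvd_natCast.1 h1
  have hden1 : 1 ≤ Q.den := Q.den_pos
  have hdenR : Q.den ≤ R := (Nat.le_of_dvd (by omega) hden).trans hqR'
  have hd0 : (0 : ℝ) < Q.den := by exact_mod_cast Q.den_pos
  have hdR : 1 / (R : ℝ) ≤ 1 / Q.den := one_div_le_one_div_of_le hd0 (by exact_mod_cast hdenR)
  have hcast : (a : ℝ) / q = (Q.num : ℝ) / Q.den := by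
    have h1 : ((Q : ℚ) : ℝ) = (Q.num : ℝ) / Q.den := by exact_mod_cast (Rat.num_div_den Q).symm
    rw [← h1, hQ]
    push_cast
    rfl
  rw [hcast]
  rcases lt_or_ge Q.num 0 with hneg | hnn
  · -- `Q.num ≤ -1`: `θ − num/den ≥ 1/den ≥ 1/R > ρ`
    have h1 : (1 : ℝ) ≤ -(Q.num : ℝ) := by
      have h2 : Q.num ≤ -1 := by omega
      have h3 : (Q.num : ℝ) ≤ -1 := by exact_mod_cast h2
      linarith
    have h2 : 1 / (Q.den : ℝ) ≤ -(Q.num : ℝ) / Q.den := div_le_div_of_nonneg_right h1 hd0.le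
    have h3 : ρ < θ - Q.num / Q.den := by rw [neg_div] at h2; linarith
    exact lt_of_lt_of_le h3 (le_abs_self _)
  · rcases le_or_gt Q.num Q.den with hle | hgt
    · -- a reduced fraction of `[0, 1]`: the hypothesis
      have key := h Q.den hden1 hdenR Q.num.natAbs (by omega) Q.reduced
      have hc : ((Q.num.natAbs : ℕ) : ℝ) = (Q.num : ℝ) := by
        rw [Nat.cast_natAbs, Int.cast_abs, abs_of_nonneg (by exact_mod_cast hnn)]
      rwa [hc] at key
    · -- `Q.num ≥ den + 1`: `num/den − θ > 1/den ≥ 1/R > ρ`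
      have h1 : (Q.den : ℝ) + 1 ≤ Q.num := by exact_mod_cast (by omega : (Q.den : ℤ) + 1 ≤ Q.num)
      have h2 : 1 + 1 / (Q.den : ℝ) ≤ (Q.num : ℝ) / Q.den := by
        rw [le_div_iff₀ hd0, add_mul, one_mul, one_div_mul_cancel hd0.ne']
        linarith
      have h3 : ρ < Q.num / Q.den - θ := by linarith
      exact lt_of_lt_of_le h3 (by rw [abs_sub_comm]; exact le_abs_self _)

end SmoothArcs

end Literature.NumberTheory.Sieve

end
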